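import Mathlib
import Summits.KontsevichZagierPeriods.KontsevichZagierPeriods.Theorems.SoloInformedAyoubComplexSym
import Summits.KontsevichZagierPeriods.KontsevichZagierPeriods.Theorems.SoloInformedAyoubTheta
import HarnessLib
import HarnessLib.Audit

/-!
# SoloInformed — the residue is `π`-cancellation at one explicit element (Theorem B‴)

`Theorems/SoloInformedKZSaturation.lean` reduced the Kontsevich–Zagier period conjecture (KZP),
granting separation of poles, Nash cubulation and Ayoub's conjecture in LOCALISED form, to the
saturation statement `KZSat` (`evalP p ≠ 0 → p·q = 0 → q = 0` in the formal period ring `P`), and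
proved `KZP → KZSat`.  Here the residual is cut down to ONE element of `P`.

* **Ayoub's `θ₀`.**  Ayoub's ring is `𝒫 = 𝒫^eff[θ⁻¹]` for a well-chosen `θ ∈ 𝒪_alg(𝔻¹)` of
  integral `2πi` [Ayoub 2014, Def. 10; Huber–Müller-Stach 2017, Def. 13.2.20].  We fix
  `θ₀ := i · h₀`, `h₀ = 8/((t − 1)² + 1)` (`Theorems/SoloInformedAyoubTheta.lean`, `∫₀¹ h₀ = 2π`):
  `θ₀ = dlog φ` for the algebraic loop `φ(z) = ((z − 1 − i)/(z − 1 + i))⁴`, `φ(0) = φ(1) = 1`,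
  pole- and zero-free on `|z| ≤ 1` and of winding number `1` (`soloInformed_thetaLoop_*` below), so
  that the class of `θ₀` is the class of `[𝔾_m, {1}, dX/X, S¹]`, the element inverted in Nori's
  `P̃ = P̃^eff[per⁻¹]` [Huber–Müller-Stach 2017, Def. 13.1.1].  As a typed complex symbol,
  `θ₀ = (0, [h₀])` (`soloInformedTheta₀`).
* `SoloInformedAyoubEvInjLocTheta` — Ayoub's conjecture [Ayoub 2014, Conj. 7] pulled back along
  `𝒫^eff → 𝒫^eff[θ₀⁻¹]`, for our `ℤ`-typed symbols: a symbol of period `0` is killed by `k θ₀^N`.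
  It implies the `∃ θ` form `SoloInformedAyoubEvInjLocSym`.
* `SoloInformedPiSatTheta` — **the residual**: `⟦Ψ[h₀]⟧`, the class in `P` of the period
  `2π = ∫₀¹ 8 dt/((t−1)²+1)`, is a non-zero-divisor of `P`.  `SoloInformedPiNormSat` — the
  `θ`-uniform version: for every complex symbol `θ = (θ₁, θ₂)` of period `2πi`, the NORM
  `⟦Ψθ₁⟧² + ⟦Ψθ₂⟧²` is a non-zero-divisor (a norm is needed: `θ^N (k x, 0) ∈ Rel²` only gives
  `k⟦Ψx⟧·A_N = k⟦Ψx⟧·B_N = 0` with `A_N² + B_N² = (⟦Ψθ₁⟧² + ⟦Ψθ₂⟧²)^N`, `soloInformed_cpow_norm`).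
* `SoloInformedPsiKerQ` — the hub: every symbol of period `0` maps, up to a multiple, to a KZ
  relation; `soloInformed_ayoubTransferKer : Presentation → PsiKerQ → KZP` (as THEOREM D_A) and
  `KZP → PsiKerQ`.
* Chains and converses: `KZSat → PiNormSat → PiSatTheta`, `KZP → PiSatTheta`;
  `soloInformed_ayoubTransferTheta₈ : SeparationOfPoles → NashCubulation → AyoubEvInjLocTheta →
  PiSatTheta → KZP`; hence (`soloInformed_kzp_iff_piSatTheta`) **granting separation of poles,
  Nash cubulation and Ayoub's conjecture localised at `θ₀`, KZP ⟺ "the period `2π = ∫₀¹ h₀` is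
  a non-zero-divisor of the formal period ring"** — one cancellation statement about one element.

Motivic reading (paper `kz-saturation.md` §3ter, not formalised): under the comparison of the
naive ring with Nori's effective period algebra, `PiSatTheta` is the statement that
`per = [𝔾_m,{1},dX/X,S¹]` is a non-zero-divisor of `P̃^eff(ℚ)`, i.e. that `P̃^eff(ℚ) → P̃(ℚ)` is
injective, i.e. [Huber–Müller-Stach 2017, Rem. 9.3.5] that `MM^eff_Nori(ℚ) ⊂ MM_Nori(ℚ)` is full —
recorded there and in [André 2018, p. 4] as not known.

References: J. Ayoub, EMS Newsl. 91 (2014), Def. 10, Conj. 7, Prop. 11, Rem. 12–13; J. Ayoub,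
*Une version relative de la conjecture des périodes de Kontsevich–Zagier*, Ann. Math. 181 (2015),
Conj. 1.1, Fait 1.4, Lemme 3.12; A. Huber, S. Müller-Stach, *Periods and Nori motives* (2017),
Def. 13.1.1, Rem. 9.3.5, Prop. 13.2.21; Y. André, *A note on 1-motives*, arXiv:1807.09121, p. 4;
M. Kontsevich, D. Zagier, *Periods* (2001), §1.2.
-/

noncomputable section

open scoped BigOperators
open Set MeasureTheory
open Literature.NumberTheory.Transcendental Literature.NumberTheory.Transcendental.KZ

namespace Summit.KontsevichZagierPeriods.KontsevichZagierPeriods.Theorems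

/-! ### Non-zero-divisors of the formal period ring -/

/-- `p` is a non-zero-divisor of the formal period ring `P = FormalRep ⧸ relations`. -/
def SoloInformedNZD (p : FormalPeriodRing) : Prop :=
  ∀ q : FormalPeriodRing, p * q = 0 → q = 0

/-- Products of non-zero-divisors are non-zero-divisors. -/
theorem soloInformed_nzd_mul {p p' : FormalPeriodRing} (hp : SoloInformedNZD p)
    (hp' : SoloInformedNZD p') : SoloInformedNZD (p * p') :=
  fun q h => hp' q (hp _ (by rw [← mul_assoc]; exact h))

/-- Powers of a non-zero-divisor are non-zero-divisors. -/
theorem soloInformed_nzd_pow {p : FormalPeriodRing} (hp : SoloInformedNZD p) :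
    ∀ N : ℕ, SoloInformedNZD (p ^ N)
  | 0 => fun q h => by simpa using h
  | N + 1 => by
    rw [pow_succ]
    exact soloInformed_nzd_mul (soloInformed_nzd_pow hp N) hp

/-- If `p²` is a non-zero-divisor, so is `p`. -/
theorem soloInformed_nzd_of_sq {p : FormalPeriodRing} (hp : SoloInformedNZD (p ^ 2)) :
    SoloInformedNZD p :=
  fun q h => hp q (by rw [pow_two, mul_assoc, h, mul_zero])

/-- Under `KZSat`, every element of non-zero period is a non-zero-divisor (this is `KZSat`). -/
theorem soloInformed_nzd_of_kzSat (hS : SoloInformedKZSat) {p : FormalPeriodRing}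
    (hp : evalP p ≠ 0) : SoloInformedNZD p :=
  fun q h => hS p q hp h

/-- **Norm identity** for `θ^N = A_N + i B_N`: `A_N² + B_N² = (G² + H²)^N`. -/
theorem soloInformed_cpow_norm (G H : FormalPeriodRing) (N : ℕ) :
    (soloInformedCPow G H N).1 ^ 2 + (soloInformedCPow G H N).2 ^ 2 = (G ^ 2 + H ^ 2) ^ N := by
  induction N with
  | zero => simp [soloInformedCPow]
  | succ N ih =>
    simp only [soloInformedCPow]
    rw [pow_succ (G ^ 2 + H ^ 2) N, ← ih]
    ring

/-! ### The hub: symbols of period zero map to KZ relations -/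

/-- **KZ-side kernel property** (up to torsion): every formal combination of Ayoub generators of
period `0` is mapped by `Ψ`, after a non-zero multiple, to a KZ relation.  Implied by Ayoub's
conjecture in effective form (`soloInformedAyoubPsi_rel`), by KZP (`soloInformed_psiKerQ_of_kzp`),
and by localised injectivity plus cancellation (below); OPEN, used as a hypothesis.
[cite: Ayoub2014, Conj. 7, Rem. 13] -/
@[conjecture] def SoloInformedPsiKerQ : Prop :=
  ∀ y : SoloInformedAyoubSymbols, soloInformedAyoubEv y = 0 →
    ∃ N : ℕ, N ≠ 0 ∧ soloInformedAyoubPsi soloInformed_ayoubLemmaQ (N • y) ∈ relations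

/-- KZP implies the kernel property (with `N = 1`): `evalP ⟦Ψ y⟧ = Re (Ev y) = 0` and `evalP` is
injective under KZP. -/
theorem soloInformed_psiKerQ_of_kzp (h : KontsevichZagierPeriods) : SoloInformedPsiKerQ := by
  intro y hy
  refine ⟨1, one_ne_zero, ?_⟩
  rw [one_smul, ← toFormalPeriod_eq_zero_iff]
  apply soloInformed_evalP_injective_of_kzp h
  rw [map_zero]
  have h1 := soloInformed_evalP_toFormalPeriod_psi soloInformed_ayoubLemmaQ y
  rw [hy] at h1
  exact_mod_cast h1

/-- **Transfer through the hub** (THEOREM D_A with the kernel property in place of Ayoub's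
conjecture): THEOREM P_A writes `k[r]`, `k'[r']` as `Ψ` of real symbols `x`, `x'`; equal periods
give `Ev (k' x − k x') = 0`; the kernel property makes `Ψ (N (k' x − k x'))` a KZ relation, whence
`(N k k') • ([r] − [r'])` is one, and FACT M removes the multiple. [Ayoub 2014, Rem. 13] -/
theorem soloInformed_ayoubTransferKer (hP : SoloInformedAyoubPresentation)
    (hK : SoloInformedPsiKerQ) : KontsevichZagierPeriods := by
  have hQ := soloInformed_ayoubLemmaQ
  refine KontsevichZagierPeriods_iff.2 fun n n' r r' _ _ hv => ?_
  obtain ⟨k, hk, m, d, a, c, ρ, hρd, hρi, hrel⟩ := hP n r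
  obtain ⟨k', hk', m', d', a', c', ρ', hρd', hρi', hrel'⟩ := hP n' r'
  set x : SoloInformedAyoubSymbols := ∑ j, c j • soloInformedAyoubOf (a j) with hx
  set x' : SoloInformedAyoubSymbols := ∑ j, c' j • soloInformedAyoubOf (a' j) with hx'
  have hψ : soloInformedAyoubPsi hQ x - k • of r ∈ relations :=
    soloInformedAyoubPsi_presentation hQ r a c ρ hρd hρi hrel
  have hψ' : soloInformedAyoubPsi hQ x' - k' • of r' ∈ relations :=
    soloInformedAyoubPsi_presentation hQ r' a' c' ρ' hρd' hρi' hrel'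
  have hre := soloInformedAyoubEv_re_eq hQ r k x hψ
  have hre' := soloInformedAyoubEv_re_eq hQ r' k' x' hψ'
  have him : (soloInformedAyoubEv x).im = 0 := soloInformedAyoubEv_sum_im hQ a c
  have him' : (soloInformedAyoubEv x').im = 0 := soloInformedAyoubEv_sum_im hQ a' c'
  have hy : soloInformedAyoubEv (k' • x - k • x') = 0 := by
    apply Complex.ext
    · rw [map_sub, map_nsmul, map_nsmul, nsmul_eq_mul, nsmul_eq_mul, Complex.sub_re,
        Complex.mul_re, Complex.mul_re, hre, hre', him, him', hv]
      simp only [Complex.natCast_re, Complex.natCast_im, zero_mul, sub_zero, Complex.zero_re]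
      ring
    · rw [map_sub, map_nsmul, map_nsmul, nsmul_eq_mul, nsmul_eq_mul, Complex.sub_im,
        Complex.mul_im, Complex.mul_im, hre, hre', him, him']
      simp
  obtain ⟨N, hN, hΨy⟩ := hK _ hy
  have e2 : soloInformedAyoubPsi hQ (N • (k' • x - k • x')) =
      N • (k' • soloInformedAyoubPsi hQ x - k • soloInformedAyoubPsi hQ x') := by
    simp only [map_nsmul, map_sub]
  have hkk : (N * (k * k')) • (of r - of r') ∈ relations := by
    rw [soloInformed_smul_identity (soloInformedAyoubPsi hQ x) (soloInformedAyoubPsi hQ x')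
      (of r) (of r') N k k', ← e2]
    exact relations.add_mem (relations.sub_mem hΨy (relations.nsmul_mem hψ _))
      (relations.nsmul_mem hψ' _)
  exact soloInformed_equivalent_of_nsmul_sub_mem (mul_ne_zero hN (mul_ne_zero hk hk')) hkk

/-! ### Localised injectivity at a given `θ`, and cancellation of its norm -/

/-- Ayoub's conjecture localised AT the complex symbol `θ = (θ₁, θ₂)`: a symbol `x` of period `0`
has `θ^N · (k x) ∈ Rel ⊗ ℤ[i]` for some `N` and `k ≠ 0` (multiplication `soloInformedMulThetaSym`).
`SoloInformedAyoubEvInjLocSym` is `∃ θ, Ev θ = 2πi ∧ SoloInformedAyoubLocAt θ`. -/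
def SoloInformedAyoubLocAt (θ : SoloInformedAyoubSymbols × SoloInformedAyoubSymbols) : Prop :=
  ∀ x : SoloInformedAyoubSymbols, soloInformedAyoubEv x = 0 →
    ∃ N k : ℕ, k ≠ 0 ∧
      ((soloInformedMulThetaSym θ)^[N] (k • x, 0)).1 ∈ soloInformedAyoubRel ∧
      ((soloInformedMulThetaSym θ)^[N] (k • x, 0)).2 ∈ soloInformedAyoubRel

/-- **Norm cancellation**: if `θ^N (k x, 0) ∈ Rel²` then `k ⟦Ψ x⟧ · (⟦Ψθ₁⟧² + ⟦Ψθ₂⟧²)^N = 0`;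
so localised injectivity at `θ` plus "the norm of `θ` is a non-zero-divisor of `P`" give the
kernel property. -/
theorem soloInformed_psiKerQ_of_locAt {θ : SoloInformedAyoubSymbols × SoloInformedAyoubSymbols}
    (hloc : SoloInformedAyoubLocAt θ)
    (hW : SoloInformedNZD
      (toFormalPeriod (soloInformedAyoubPsi soloInformed_ayoubLemmaQ θ.1) ^ 2 +
        toFormalPeriod (soloInformedAyoubPsi soloInformed_ayoubLemmaQ θ.2) ^ 2)) :
    SoloInformedPsiKerQ := by
  intro x hx
  obtain ⟨N, k, hk, h₁, h₂⟩ := hloc x hx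
  refine ⟨k, hk, ?_⟩
  set Ψ := soloInformedAyoubPsi soloInformed_ayoubLemmaQ with hΨ
  set G := toFormalPeriod (Ψ θ.1) with hG
  set H := toFormalPeriod (Ψ θ.2) with hH
  set X := toFormalPeriod (Ψ (k • x)) with hX
  obtain ⟨hit₁, hit₂⟩ :=
    soloInformed_toFormalPeriod_psi_mulThetaSym_iterate soloInformed_ayoubLemmaQ θ N (k • x, 0)
  rw [← hΨ, ← hG, ← hH] at hit₁ hit₂
  simp only [map_zero, zero_mul, sub_zero, add_zero] at hit₁ hit₂
  rw [toFormalPeriod_eq_zero_iff.2 (soloInformedAyoubPsi_rel _ h₁), ← hX, eq_comm] at hit₁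
  rw [toFormalPeriod_eq_zero_iff.2 (soloInformedAyoubPsi_rel _ h₂), ← hX, eq_comm] at hit₂
  rw [← toFormalPeriod_eq_zero_iff, ← hX]
  refine soloInformed_nzd_pow hW N X ?_
  rw [← soloInformed_cpow_norm, mul_comm, mul_add, pow_two, pow_two, ← mul_assoc, hit₁,
    ← mul_assoc, hit₂, zero_mul, zero_mul, add_zero]

/-- **`PiNormSat`** — the `θ`-uniform residual: for every complex symbol `θ` of period `2πi`, the
norm `⟦Ψθ₁⟧² + ⟦Ψθ₂⟧²` (of period `4π² ≠ 0`) is a non-zero-divisor of `P`.  A consequence of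
`KZSat`, hence of KZP; OPEN otherwise. [Kontsevich–Zagier 2001, §1.2; Ayoub 2014, Def. 10] -/
@[conjecture] def SoloInformedPiNormSat : Prop :=
  ∀ θ : SoloInformedAyoubSymbols × SoloInformedAyoubSymbols,
    soloInformedAyoubEv θ.1 + soloInformedAyoubEv θ.2 * Complex.I = 2 * Real.pi * Complex.I →
      SoloInformedNZD
        (toFormalPeriod (soloInformedAyoubPsi soloInformed_ayoubLemmaQ θ.1) ^ 2 +
          toFormalPeriod (soloInformedAyoubPsi soloInformed_ayoubLemmaQ θ.2) ^ 2)

/-- The periods of the components of a symbol of period `2πi`: `evalP ⟦Ψθ₁⟧ = 0`,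
`evalP ⟦Ψθ₂⟧ = 2π`. -/
theorem soloInformed_evalP_of_ev_eq_two_pi_I
    {θ : SoloInformedAyoubSymbols × SoloInformedAyoubSymbols}
    (hθ : soloInformedAyoubEv θ.1 + soloInformedAyoubEv θ.2 * Complex.I =
      2 * Real.pi * Complex.I) :
    evalP (toFormalPeriod (soloInformedAyoubPsi soloInformed_ayoubLemmaQ θ.1)) = 0 ∧
      evalP (toFormalPeriod (soloInformedAyoubPsi soloInformed_ayoubLemmaQ θ.2)) = 2 * Real.pi := by
  rw [← soloInformed_evalP_toFormalPeriod_psi soloInformed_ayoubLemmaQ θ.1,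
    ← soloInformed_evalP_toFormalPeriod_psi soloInformed_ayoubLemmaQ θ.2] at hθ
  exact ⟨by simpa using congrArg Complex.re hθ, by simpa using congrArg Complex.im hθ⟩

/-- `KZSat → PiNormSat`: the norm has period `0² + (2π)² ≠ 0`. -/
theorem soloInformed_piNormSat_of_kzSat (hS : SoloInformedKZSat) : SoloInformedPiNormSat := by
  intro θ hθ
  obtain ⟨h1, h2⟩ := soloInformed_evalP_of_ev_eq_two_pi_I hθ
  refine soloInformed_nzd_of_kzSat hS ?_
  rw [map_add, map_pow, map_pow, h1, h2]
  positivity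

/-- `KZP → PiNormSat`. -/
theorem soloInformed_piNormSat_of_kzp (h : KontsevichZagierPeriods) : SoloInformedPiNormSat :=
  soloInformed_piNormSat_of_kzSat (soloInformed_kzSat_of_kzp h)

/-- The presentation hypothesis THEOREM P_A from separation of poles and Nash cubulation
(`Theorems/SoloInformedCubeResolution.lean`, `…VolumeResolution.lean`, `…SemialgebraicGerms.lean`). -/
theorem soloInformed_presentation₈ (H₂ : SoloInformedSeparationOfPoles)
    (hN : SoloInformedNashCubulation) : SoloInformedAyoubPresentation :=
  soloInformed_presentation_of_cubeResolution
    (soloInformed_cubeResolution_of_volumes H₂ (soloInformed_volumeResolution_of_cube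
      (soloInformed_cubeVolumeResolution_of_nashCubulation hN)))

/-- **Transfer, norm form**: `SeparationOfPoles → NashCubulation → AyoubEvInjLocSym → PiNormSat →
KZP`.  Sharpens `soloInformed_ayoubTransferSym₈` (`KZSat` replaced by `PiNormSat`). -/
theorem soloInformed_ayoubTransferNorm₈ (H₂ : SoloInformedSeparationOfPoles)
    (hN : SoloInformedNashCubulation) (hI : SoloInformedAyoubEvInjLocSym)
    (hS : SoloInformedPiNormSat) : KontsevichZagierPeriods := by
  obtain ⟨θ, hθ, hloc⟩ := hI
  exact soloInformed_ayoubTransferKer (soloInformed_presentation₈ H₂ hN)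
    (soloInformed_psiKerQ_of_locAt hloc (hS θ hθ))

/-- **Granting separation of poles, Nash cubulation and `AyoubEvInjLocSym`, KZP ⟺ PiNormSat.** -/
theorem soloInformed_kzp_iff_piNormSat (H₂ : SoloInformedSeparationOfPoles)
    (hN : SoloInformedNashCubulation) (hI : SoloInformedAyoubEvInjLocSym) :
    KontsevichZagierPeriods ↔ SoloInformedPiNormSat :=
  ⟨soloInformed_piNormSat_of_kzp, soloInformed_ayoubTransferNorm₈ H₂ hN hI⟩

/-! ### Ayoub's `θ₀ = i · 8/((t−1)²+1)` and the one-element residual -/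

/-- Ayoub's `θ₀ := i·h₀`, `h₀ = 8/((t−1)²+1)`, as the complex symbol `(0, [h₀])` (period `2πi`). -/
def soloInformedTheta₀ : SoloInformedAyoubSymbols × SoloInformedAyoubSymbols :=
  (0, soloInformedAyoubOf soloInformedThetaIm)

/-- `Ev θ₀ = 2πi`. -/
theorem soloInformedTheta₀_ev :
    soloInformedAyoubEv soloInformedTheta₀.1 + soloInformedAyoubEv soloInformedTheta₀.2 * Complex.I =
      2 * Real.pi * Complex.I := by
  simp only [soloInformedTheta₀, map_zero, zero_add, soloInformedAyoubEv_thetaIm]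
  push_cast
  ring

/-- **Ayoub's conjecture localised at `θ₀`** — [Ayoub 2014, Conj. 7] pulled back along
`𝒫^eff → 𝒫 = 𝒫^eff[θ₀⁻¹]` [Ayoub 2014, Def. 10], for `ℤ`-typed symbols: a symbol of period `0` is
killed in `Symbols²/Rel²` by `k θ₀^N` for some `N`, `k ≠ 0`.  Granting Grothendieck's period
conjecture for Nori motives it follows from the comparison `𝒫 ≅ P̃(ℚ)` [Huber–Müller-Stach 2017,
Prop. 13.2.21] once the class of `θ₀ = dlog φ` is identified with Nori's `per`; OPEN, used only
as a hypothesis. [cite: Ayoub2014, Conj. 7, Def. 10, Prop. 11] -/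
@[conjecture] def SoloInformedAyoubEvInjLocTheta : Prop :=
  SoloInformedAyoubLocAt soloInformedTheta₀

/-- The `θ₀`-form implies the `∃ θ` form. -/
theorem soloInformed_evInjLocSym_of_theta (h : SoloInformedAyoubEvInjLocTheta) :
    SoloInformedAyoubEvInjLocSym :=
  ⟨soloInformedTheta₀, soloInformedTheta₀_ev, h⟩

/-- **`PiSatTheta` — the one-element residual**: the class in `P` of the period
`2π = ∫₀¹ 8 dt/((t−1)²+1)` (the integral representation `Ψ[h₀]` on `[0,1]`) is a non-zero-divisor
of the formal period ring.  A consequence of KZP (`soloInformed_piSatTheta_of_kzp`); conversely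
it implies KZP granting separation of poles, Nash cubulation and `SoloInformedAyoubEvInjLocTheta`
(`soloInformed_ayoubTransferTheta₈`).  OPEN. [Kontsevich–Zagier 2001, §1.2] -/
@[conjecture] def SoloInformedPiSatTheta : Prop :=
  SoloInformedNZD
    (toFormalPeriod (soloInformedAyoubPsi soloInformed_ayoubLemmaQ
      (soloInformedAyoubOf soloInformedThetaIm)))

/-- `PiNormSat → PiSatTheta`: at `θ₀` the norm is `0² + ⟦Ψ[h₀]⟧²`. -/
theorem soloInformed_piSatTheta_of_piNormSat (h : SoloInformedPiNormSat) :
    SoloInformedPiSatTheta := by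
  have hW := h soloInformedTheta₀ soloInformedTheta₀_ev
  simp only [soloInformedTheta₀, map_zero, ne_eq, OfNat.ofNat_ne_zero, not_false_eq_true,
    zero_pow, zero_add] at hW
  exact soloInformed_nzd_of_sq hW

/-- `KZP → PiSatTheta`. -/
theorem soloInformed_piSatTheta_of_kzp (h : KontsevichZagierPeriods) : SoloInformedPiSatTheta :=
  soloInformed_piSatTheta_of_piNormSat (soloInformed_piNormSat_of_kzp h)

/-- `PiSatTheta` gives the norm of `θ₀` as a non-zero-divisor. -/
theorem soloInformed_nzd_norm_theta₀ (h : SoloInformedPiSatTheta) :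
    SoloInformedNZD
      (toFormalPeriod (soloInformedAyoubPsi soloInformed_ayoubLemmaQ soloInformedTheta₀.1) ^ 2 +
        toFormalPeriod (soloInformedAyoubPsi soloInformed_ayoubLemmaQ soloInformedTheta₀.2) ^ 2) := by
  simp only [soloInformedTheta₀, map_zero, ne_eq, OfNat.ofNat_ne_zero, not_false_eq_true,
    zero_pow, zero_add]
  rw [pow_two]
  exact soloInformed_nzd_mul h h

/-- **Transfer at `θ₀`**: `Presentation → AyoubEvInjLocTheta → PiSatTheta → KZP`. -/
theorem soloInformed_ayoubTransferTheta (hP : SoloInformedAyoubPresentation)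
    (hI : SoloInformedAyoubEvInjLocTheta) (hS : SoloInformedPiSatTheta) :
    KontsevichZagierPeriods :=
  soloInformed_ayoubTransferKer hP (soloInformed_psiKerQ_of_locAt hI (soloInformed_nzd_norm_theta₀ hS))

/-- **THEOREM B‴ (transfer chain)**:
`SeparationOfPoles → NashCubulation → AyoubEvInjLocTheta → PiSatTheta → KontsevichZagierPeriods`. -/
theorem soloInformed_ayoubTransferTheta₈ (H₂ : SoloInformedSeparationOfPoles)
    (hN : SoloInformedNashCubulation) (hI : SoloInformedAyoubEvInjLocTheta)
    (hS : SoloInformedPiSatTheta) : KontsevichZagierPeriods :=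
  soloInformed_ayoubTransferTheta (soloInformed_presentation₈ H₂ hN) hI hS

/-- **THEOREM B‴**: granting separation of poles [van den Dries–Speissegger], Nash cubulation and
Ayoub's conjecture localised at `θ₀`, **the Kontsevich–Zagier period conjecture is equivalent to
the single cancellation statement "`⟦∫₀¹ 8 dt/((t−1)²+1)⟧ = ⟦2π⟧` is a non-zero-divisor of the
formal period ring"**. -/
theorem soloInformed_kzp_iff_piSatTheta (H₂ : SoloInformedSeparationOfPoles)
    (hN : SoloInformedNashCubulation) (hI : SoloInformedAyoubEvInjLocTheta) :
    KontsevichZagierPeriods ↔ SoloInformedPiSatTheta :=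
  ⟨soloInformed_piSatTheta_of_kzp, soloInformed_ayoubTransferTheta₈ H₂ hN hI⟩

/-! ### `θ₀` is the logarithmic derivative of an algebraic loop of winding number one -/

/-- The algebraic loop `φ(z) = ((z − 1 − i)/(z − 1 + i))⁴` (a rational function over `ℚ(i)`,
regular and non-vanishing on `|z| < √2`). -/
def soloInformedThetaLoop (z : ℂ) : ℂ := ((z - 1 - Complex.I) / (z - 1 + Complex.I)) ^ 4

/-- `φ(0) = 1` (indeed `(−1−i)/(−1+i) = i` and `i⁴ = 1`). -/
theorem soloInformed_thetaLoop_zero : soloInformedThetaLoop 0 = 1 := by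
  have h : ((0 : ℂ) - 1 - Complex.I) / (0 - 1 + Complex.I) = Complex.I := by
    rw [div_eq_iff (by
      intro h0
      have := congrArg Complex.im h0
      simp at this)]
    ring_nf
    rw [Complex.I_sq]
    ring
  rw [soloInformedThetaLoop, h]
  calc Complex.I ^ 4 = (Complex.I ^ 2) ^ 2 := by ring
    _ = 1 := by rw [Complex.I_sq]; ring

/-- `φ(1) = 1` (indeed `(−i)/i = −1`). -/
theorem soloInformed_thetaLoop_one : soloInformedThetaLoop 1 = 1 := by
  have h : ((1 : ℂ) - 1 - Complex.I) / (1 - 1 + Complex.I) = -1 := by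
    rw [sub_self, zero_sub, zero_add, neg_div, div_self Complex.I_ne_zero]
  rw [soloInformedThetaLoop, h]
  norm_num

/-- **`θ₀ = dlog φ`**: `φ'(z) = φ(z) · i · 8/((z − 1)² + 1)` wherever `(z − 1)² + 1 ≠ 0`; with
`φ(0) = φ(1) = 1` and `∫₀¹ θ₀ = 2πi` (`soloInformed_integral_theta`), `φ ∘ [0,1]` is a closed
algebraic loop in `ℂ^×` of winding number `1`, so the class of `θ₀ dz = dφ/φ` in an effective
period algebra is that of `[𝔾_m, {1}, dX/X, S¹]`. [Huber–Müller-Stach 2017, Def. 13.1.1] -/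
theorem soloInformed_thetaLoop_hasDerivAt {z : ℂ} (hz : (z - 1) ^ 2 + 1 ≠ 0) :
    HasDerivAt soloInformedThetaLoop
      (soloInformedThetaLoop z * (Complex.I * (8 / ((z - 1) ^ 2 + 1)))) z := by
  have hfac : (z - 1) ^ 2 + 1 = (z - 1 - Complex.I) * (z - 1 + Complex.I) := by
    ring_nf
    rw [Complex.I_sq]
    ring
  have hm : z - 1 - Complex.I ≠ 0 := fun h => hz (by rw [hfac, h, zero_mul])
  have hp : z - 1 + Complex.I ≠ 0 := fun h => hz (by rw [hfac, h, mul_zero])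
  have hnum : HasDerivAt (fun w : ℂ => w - 1 - Complex.I) 1 z := by
    simpa using ((hasDerivAt_id z).sub_const 1).sub_const Complex.I
  have hden : HasDerivAt (fun w : ℂ => w - 1 + Complex.I) 1 z := by
    simpa using ((hasDerivAt_id z).sub_const 1).add_const Complex.I
  have hq : HasDerivAt (fun w => ((w - 1 - Complex.I) / (w - 1 + Complex.I)) ^ 4)
      (((4 : ℕ) : ℂ) * ((z - 1 - Complex.I) / (z - 1 + Complex.I)) ^ 3 *
        ((1 * (z - 1 + Complex.I) - (z - 1 - Complex.I) * 1) / (z - 1 + Complex.I) ^ 2)) z :=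
    (hnum.div hden hp).pow 4
  refine hq.congr_deriv ?_
  rw [soloInformedThetaLoop, hfac]
  set a := z - 1 - Complex.I with ha
  set b := z - 1 + Complex.I with hb
  have hba : 1 * b - a * 1 = 2 * Complex.I := by rw [ha, hb]; ring
  rw [hba]
  push_cast
  field_simp
  ring

end Summit.KontsevichZagierPeriods.KontsevichZagierPeriods.Theorems
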